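import Literature.MathematicalPhysics.QuantumFieldTheory.Balaban1983to89.B9Thm311SmallFieldPathZd
import Literature.MathematicalPhysics.QuantumFieldTheory.Balaban1983to89.B9Thm311ContinuityMethodZd

/-!
# `Balaban1983to89.B9Thm311SmallFieldPathZdContinuity` — [Balaban1985BackgroundPropagators] Thm 3.11 p. 416: THE CONTINUITY-METHOD REDUCTION RUN ON THE
# PATH-CONNECTED SMALL-FIELD FAMILIES — positivity of the genuine `Δ_a(U₀)` on `E_𝔤(□₀)` (and existence of `G_𝔤(U₀)`) on the WHOLE window-sized ball around
# the flat background, and on its gauge translate around every pure gauge `1^w`, FROM print's a-priori coercivity bound at the positive points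

statement-level skeleton of published theorems with citation tags; proofs where landed; nothing here is a claim about the
Yang–Mills mass gap

`[Balaban1985BackgroundPropagators]` ("B9", CMP **99** (1985) 389–434) p. 416, Theorem 3.11 and its proof (*«In [4] we have proved that the operator G_□(1)
is positive»*; the curved case from the representations of `G` in Sects. B–E and the bound (3.115) p. 418); p. 396 (3.34)–(3.36) (gauge covariance; the
class is a ball modulo gauge, cube by cube).  PDF held: `paper:balaban1985-cmp99-background-propagators` pp. 396, 416–418.

CITATION HEADER ∕ WHY THIS FILE (cell `pub-ymgap`, HUMAN RULING D-0062 ∕ D-0149; width seat `pub-ymgap-dag-n06-w3` (g4), node N06 = [B9]; CLAIM-1, second half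
(split from `B9Thm311SmallFieldPathZd` by the 400-line rule); count-neutral).  dag-n06-w4 g3's `B9Thm311ContinuityMethodZd` (p614111) proves, for ANY
preconnected `S ⊆ 𝒰′` with a positive base point: uniform coercivity at the positive points of `S` ⟹ positivity on all of `S` (`bondPair_pos_on_of_isPreconnected`,
`bondPair_pos_on_reg17UnivP_of_coercive`, `regularAtH_on_reg17UnivP_of_coercive`); its in-file A6 is `S = {1}`.  The companion `B9Thm311SmallFieldPathZd` makes
the uniform `δ`-ball (`4δ < (α_Q∕L²)L^{−2m}`) and its gauge translates preconnected subsets of `𝒰′`; THIS FILE instantiates the reduction on them.  The base point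
of a translated ball is the PURE GAUGE `1^w`, positive by dag-n06-b's flat positivity `B9Thm311FlatHermKernelZd.flat_posDef_herm_cube` transported along the orbit
by this seat's g3 `B9Eq334GaugeCovarianceZdHerm.posDefH_gaugeAct` over `B9Eq334GaugeCovarianceZd.letterCovAt_deltaAOf_opsAllZd_of_reg17Univ`.  Further inputs
by name: dag-n06-w2 g3 `B9Eq326DeltaAHermitianZdCurved.linear_herm_on_reg17UnivP ∕ one_mem_reg17UnivP`, dag-n06-w4 g3
`B9Thm311PosDefOpenRegimeZd.lettersContinuousWithinAt_opsAllZd_cube_reg17UnivP`, `B9Eq327GreenZdHerm.regularAtH_of_bondPair_pos`.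

WHAT IS PROVED (kernel, 0 sorry; theorems only — no `def`, `instance`, `notation`).
* `alphaQ_le_one`, `delta_le_two_of_window` (window arithmetic: `4δ < (α_Q∕L²)L^{−2m}` ⟹ `δ ≤ 2`).
* ★★★ `bondPair_pos_on_ball_of_coercive` — at every cube member (class `cubeLamBP`, `m ≤ k`, `2 ≤ d`, `2 ≤ L ≤ ρ`), for `0 < δ`, `4δ < (α_Q∕L²)L^{−2m}`: IF at the
  POSITIVE points of the uniform `δ`-ball the uniform coercivity `c·⟨A, A⟩_τ ≤ ⟨A, Δ_a(U₀)A⟩_τ` holds, THEN the genuine four-letter `Δ_a(U₀)` (`opsAllZd`) is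
  positive definite on `E_𝔤(□₀)` for EVERY `U₀` of the WHOLE ball — radius EXPLICIT (the window), versus the member-dependent unconditional radius of
  `B9Eq17RegimeBallZd.exists_uniform_ball_of_eventually_reg17UnivP`; ★★★ `regularAtH_on_ball_of_coercive` (then `G_𝔤(U₀)` exists on the whole ball).
* ★★★ `bondPair_pos_on_image_ball_of_coercive` ∕ ★★★ `regularAtH_on_image_ball_of_coercive` — the same on the gauge translate of the ball by any unitary gauge
  `w` (backgrounds `δ`-close to the pure gauge `1^w` MODULO GAUGE, arbitrarily far from `1` in the sup norm), base point `1^w`.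

HONEST SCOPE.  By-name composition; CONDITIONAL on the displayed coercivity (print's (3.115)-type bound — N06's object-bound, Sects. B–E, NOT proved here);
without it the tree's unconditional statements are the member-dependent balls of dag-n06-b ∕ dag-n06-w2 ∕ dag-n06-w4.  No estimate of [B9]; preconnectedness of
`𝒰′` itself NOT proved (see the companion's LOCATED note); count-neutral; N05 ∕ N06 NOT discharged; K1⁸ `stmt-QuantumFields-26907` NOT closed; one finite `𝕋⁴`
programme at fixed `ε`, Bałaban as printed; R4 closes only the conditional finite-`𝕋⁴` rung `BalabanLadder.UV` — nothing continuum ∕ ℝ⁴ ∕ OS ∕ mass gap ∕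
Clay.  Unit `pub-ymgap-dag-n06-w3` (g4), 2026-08-28.
-/

noncomputable section

namespace Literature.MathematicalPhysics.QuantumFieldTheory.Balaban1983to89.B9Thm311SmallFieldPathZdContinuity

open scoped Topology Real
open Filter
open B7Prop1Explicit
open B7Prop2Explicit (unitaryUnits mem_unitaryUnits unitaryUnits_le_U1)
open B9Eq316AveragingTransposeZd (Reg17 alphaQ alphaQ_pos)
open B9Eq17RegimeBallZd (ball_subset_reg17UnivP)
open B9Thm311SmallFieldPathZd (one_mem_ball isPreconnected_ball gaugeAct_one_mem_image_ball isPreconnected_image_ball image_ball_subset_reg17UnivP)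

-- `Site` alone could resolve to the torus sites of `Setup.lean`; re-export the `ℤ^d` sites of `B7Prop1Explicit`.
export B7Prop1Explicit (Site)

/-! ## The continuity-method reduction RUN on the path-connected small-field families (dag-n06-w4 g3 `B9Thm311ContinuityMethodZd` by name) -/

section ContinuityMethod

open B9SupplySockB9P3ZdLetters (OpsZd deltaAOf)
open B9SupplySockB9P3ZdAllLettersZd (opsAllZd)
open B9Eq327GreenZd (bondPair)
open B9Eq327GreenZdHerm (domSubH mem_domSubH_iff RegularAtH regularAtH_of_bondPair_pos)
open B9Thm311PosDefOpenZd (cubeMember_Ω0_finite)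
open B9Thm311FlatHermKernelZd (flat_posDef_herm_cube)
open B9Thm311PosDefOpenRegimeZd (lettersContinuousWithinAt_opsAllZd_cube_reg17UnivP)
open B9Eq326DeltaAHermitianZdCurved (linear_herm_on_reg17UnivP one_mem_reg17UnivP)
open B9Thm311ContinuityMethodZd (bondPair_pos_on_of_isPreconnected bondPair_pos_on_reg17UnivP_of_coercive regularAtH_on_reg17UnivP_of_coercive)
open B9Eq334GaugeCovarianceZd (letterCovAt_deltaAOf_opsAllZd_of_reg17Univ)
open B9Eq334GaugeCovarianceZdHerm (posDefH_gaugeAct)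
open B8Eq131CubesAdmissible (cubeFam)
open B8CubeMemberZd (cubeLamS)
open B8Ineq159FlatCubeMemberPrinted (cubeLamBP)
open B8LeafModelZd (ZdIdx)

variable {d : ℕ}

/-- window arithmetic: `α_Q(d, L) ≤ 1` (its third window `1∕(25600(d+1)²(d+4)L^{d+1})`, `L ≥ 1`). [cite: Balaban1985Averaging, (145) p.40 (bookkeeping)] -/
theorem alphaQ_le_one (d : ℕ) {L : ℕ} (hL : 1 ≤ L) : alphaQ d L ≤ 1 := by
  have hL' : (1 : ℝ) ≤ L := by exact_mod_cast hL
  have h : alphaQ d L ≤ 1 / (25600 * ((d : ℝ) + 1) ^ 2 * ((d : ℝ) + 4) * (L : ℝ) ^ (d + 1)) := min_le_right _ _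
  refine h.trans ?_
  rw [div_le_one (by positivity)]
  have h1 : (1 : ℝ) ≤ ((d : ℝ) + 1) ^ 2 := one_le_pow₀ (by linarith [Nat.cast_nonneg (α := ℝ) d])
  have h2 : (1 : ℝ) ≤ (L : ℝ) ^ (d + 1) := one_le_pow₀ hL'
  have hd : (0 : ℝ) ≤ d := Nat.cast_nonneg d
  nlinarith [mul_le_mul h1 h2 (by positivity) (by positivity)]

/-- window arithmetic: `4δ < (α_Q∕L²)L^{−2m}` forces `δ ≤ 2` (indeed `δ < 1∕4`). [cite: Balaban1985Averaging, (145) p.40 (bookkeeping)] -/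
theorem delta_le_two_of_window {L : ℕ} (hL : 1 ≤ L) {m : ℕ} {δ : ℝ} (hδ : 4 * δ < alphaQ d L / (L : ℝ) ^ 2 * (((L : ℝ) ^ m)⁻¹) ^ 2) : δ ≤ 2 := by
  have hL' : (1 : ℝ) ≤ L := by exact_mod_cast hL
  have hα := alphaQ_le_one d hL
  have hα0 := alphaQ_pos d hL
  have h1 : alphaQ d L / (L : ℝ) ^ 2 ≤ 1 := by
    rw [div_le_one (by positivity)]
    exact hα.trans (one_le_pow₀ hL')
  have h2 : (((L : ℝ) ^ m)⁻¹) ^ 2 ≤ 1 := pow_le_one₀ (by positivity) (inv_le_one_of_one_le₀ (one_le_pow₀ hL'))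
  have h3 : alphaQ d L / (L : ℝ) ^ 2 * (((L : ℝ) ^ m)⁻¹) ^ 2 ≤ 1 := by
    calc alphaQ d L / (L : ℝ) ^ 2 * (((L : ℝ) ^ m)⁻¹) ^ 2 ≤ 1 * 1 := mul_le_mul h1 h2 (by positivity) (by positivity)
      _ = 1 := by ring
  linarith

variable {𝔸 : Type*} [CStarAlgebra 𝔸] [FiniteDimensional ℝ 𝔸] [Nontrivial 𝔸] {L : ℕ}
variable (τ : 𝔸 →ₗ[ℂ] ℂ) (hτp : ∀ a : 𝔸, a ≠ 0 → 0 < (τ (star a * a)).re)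
  (hτt : ∀ a b : 𝔸, τ (a * b) = τ (b * a)) (hτs : ∀ a : 𝔸, τ (star a) = starRingEnd ℂ (τ a))

include hτp hτt hτs in
/-- ★★★ **THEOREM 3.11 ON THE WHOLE WINDOW-SIZED BALL AROUND THE FLAT BACKGROUND, FROM THE A-PRIORI BOUND** — the continuity-method reduction
`bondPair_pos_on_reg17UnivP_of_coercive` (dag-n06-w4 g3) RUN on the family `S` = the uniform `δ`-ball of unitary backgrounds, `0 < δ`, `4δ < (α_Q∕L²)L^{−2m}`
(preconnected by §3, inside `𝒰′` by dag-n06-w2's `ball_subset_reg17UnivP`, containing `1`): at every cube member (class `cubeLamBP`, `m ≤ k`, `2 ≤ d`, `2 ≤ L ≤ ρ`),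
IF at the POSITIVE points of the ball the uniform coercivity `c·⟨A, A⟩_τ ≤ ⟨A, Δ_a(U₀)A⟩_τ` holds (print's (3.115)-type bound, displayed), THEN the genuine four-letter
`Δ_a(U₀)` is positive definite on `E_𝔤(□₀)` for EVERY `U₀` of the WHOLE ball — radius explicit, versus the member-dependent unconditional radius of
`B9Eq17RegimeBallZd.exists_uniform_ball_of_eventually_reg17UnivP`. [cite: Balaban1985BackgroundPropagators, Thm 3.11 p.416, (3.115) p.418, (3.36) p.396; Balaban1985RegularSpaces, (1.7) p.77, (1.131) p.99] -/
theorem bondPair_pos_on_ball_of_coercive (hd2 : 2 ≤ d) (hL2 : 2 ≤ L) (ops₀ : ℝ → ZdIdx d L → ℕ → OpsZd d 𝔸) (M : ℝ)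
    (i : ZdIdx d L) {a : Site d} {Mc ρ : ℕ} (hΩ : i.Ω = cubeFam false L a Mc ρ i.k) (hΛs : i.Λs = cubeLamS L a Mc ρ i.k) (hρ : L ≤ ρ)
    {m : ℕ} (hm : m ≤ i.k) {δ : ℝ} (hδ0 : 0 < δ) (hδ : 4 * δ < alphaQ d L / (L : ℝ) ^ 2 * (((L : ℝ) ^ m)⁻¹) ^ 2) {c : ℝ} (hc : 0 < c)
    (hcoer : ∀ U₀ ∈ {U : Site d → Fin d → 𝔸ˣ | (∀ x κ, U x κ ∈ unitaryUnits 𝔸) ∧ ∀ x κ, ‖((U x κ : 𝔸ˣ) : 𝔸) - 1‖ < δ},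
      (∀ A ∈ domSubH (𝔸 := 𝔸) (i.Ω 0), A ≠ 0 → 0 < bondPair τ A (deltaAOf i.η (opsAllZd τ L (cubeLamBP L a Mc ρ i.k) ops₀ M i m) U₀ A)) →
        ∀ A ∈ domSubH (𝔸 := 𝔸) (i.Ω 0), c * bondPair τ A A ≤ bondPair τ A (deltaAOf i.η (opsAllZd τ L (cubeLamBP L a Mc ρ i.k) ops₀ M i m) U₀ A)) :
    ∀ U₀ ∈ {U : Site d → Fin d → 𝔸ˣ | (∀ x κ, U x κ ∈ unitaryUnits 𝔸) ∧ ∀ x κ, ‖((U x κ : 𝔸ˣ) : 𝔸) - 1‖ < δ},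
      ∀ A ∈ domSubH (𝔸 := 𝔸) (i.Ω 0), A ≠ 0 → 0 < bondPair τ A (deltaAOf i.η (opsAllZd τ L (cubeLamBP L a Mc ρ i.k) ops₀ M i m) U₀ A) := by
  haveI : NeZero L := ⟨by omega⟩
  have hL1 : 1 ≤ L := le_trans (by norm_num) hL2
  exact bondPair_pos_on_reg17UnivP_of_coercive τ hτp hτt hτs hd2 hL2 ops₀ M i hΩ hΛs hρ hm (ball_subset_reg17UnivP hL1 m hδ)
    (isPreconnected_ball hδ0 (delta_le_two_of_window hL1 hδ)) (one_mem_ball hδ0) hc hcoer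

include hτp hτt hτs in
/-- ★★★ **… AND THEN `Δ_a(U₀)↾□₀` IS INVERTIBLE ON `E_𝔤(□₀)` — `G_𝔤(U₀)` EXISTS — ON THE WHOLE WINDOW-SIZED BALL** (same displayed coercivity).
[cite: Balaban1985BackgroundPropagators, Thm 3.11 p.416, (3.27) p.395, (3.115) p.418] -/
theorem regularAtH_on_ball_of_coercive (hd2 : 2 ≤ d) (hL2 : 2 ≤ L) (ops₀ : ℝ → ZdIdx d L → ℕ → OpsZd d 𝔸) (M : ℝ)
    (i : ZdIdx d L) {a : Site d} {Mc ρ : ℕ} (hΩ : i.Ω = cubeFam false L a Mc ρ i.k) (hΛs : i.Λs = cubeLamS L a Mc ρ i.k) (hρ : L ≤ ρ)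
    {m : ℕ} (hm : m ≤ i.k) {δ : ℝ} (hδ0 : 0 < δ) (hδ : 4 * δ < alphaQ d L / (L : ℝ) ^ 2 * (((L : ℝ) ^ m)⁻¹) ^ 2) {c : ℝ} (hc : 0 < c)
    (hcoer : ∀ U₀ ∈ {U : Site d → Fin d → 𝔸ˣ | (∀ x κ, U x κ ∈ unitaryUnits 𝔸) ∧ ∀ x κ, ‖((U x κ : 𝔸ˣ) : 𝔸) - 1‖ < δ},
      (∀ A ∈ domSubH (𝔸 := 𝔸) (i.Ω 0), A ≠ 0 → 0 < bondPair τ A (deltaAOf i.η (opsAllZd τ L (cubeLamBP L a Mc ρ i.k) ops₀ M i m) U₀ A)) →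
        ∀ A ∈ domSubH (𝔸 := 𝔸) (i.Ω 0), c * bondPair τ A A ≤ bondPair τ A (deltaAOf i.η (opsAllZd τ L (cubeLamBP L a Mc ρ i.k) ops₀ M i m) U₀ A)) :
    ∀ U₀ ∈ {U : Site d → Fin d → 𝔸ˣ | (∀ x κ, U x κ ∈ unitaryUnits 𝔸) ∧ ∀ x κ, ‖((U x κ : 𝔸ˣ) : 𝔸) - 1‖ < δ},
      RegularAtH i.η (opsAllZd τ L (cubeLamBP L a Mc ρ i.k) ops₀ M i m) (i.Ω 0) U₀ := by
  haveI : NeZero L := ⟨by omega⟩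
  have hL1 : 1 ≤ L := le_trans (by norm_num) hL2
  exact regularAtH_on_reg17UnivP_of_coercive τ hτp hτt hτs hd2 hL2 ops₀ M i hΩ hΛs hρ hm (ball_subset_reg17UnivP hL1 m hδ)
    (isPreconnected_ball hδ0 (delta_le_two_of_window hL1 hδ)) (one_mem_ball hδ0) hc hcoer

include hτp hτt hτs in
/-- ★★★ **THEOREM 3.11 ON THE WINDOW-SIZED BALL AROUND EVERY PURE GAUGE `1^w`, FROM THE A-PRIORI BOUND** — the carrier reduction
`bondPair_pos_on_of_isPreconnected` RUN on the family `S` = the gauge translate by a unitary `w` of the uniform `δ`-ball (`0 < δ`, `4δ < (α_Q∕L²)L^{−2m}`;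
preconnected by §4, inside `𝒰′` by `image_ball_subset_reg17UnivP`), with BASE POINT THE PURE GAUGE `1^w` — positive by the flat positivity (dag-n06-b
`flat_posDef_herm_cube`) transported along the orbit (this seat's `posDefH_gaugeAct` over `letterCovAt_deltaAOf_opsAllZd_of_reg17Univ`): uniform coercivity at the
positive points of `S` ⟹ positivity of the genuine `Δ_a(U₀)` on `E_𝔤(□₀)` for EVERY `U₀ ∈ S` — backgrounds `δ`-close to a pure gauge MODULO GAUGE, arbitrarily
far from `1` in the sup norm. [cite: Balaban1985BackgroundPropagators, Thm 3.11 p.416, (3.34)–(3.36) p.396, (3.115) p.418; Balaban1985RegularSpaces, (1.7) p.77, (1.131) p.99] -/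
theorem bondPair_pos_on_image_ball_of_coercive (hd2 : 2 ≤ d) (hL2 : 2 ≤ L) (ops₀ : ℝ → ZdIdx d L → ℕ → OpsZd d 𝔸) (M : ℝ)
    (i : ZdIdx d L) {a : Site d} {Mc ρ : ℕ} (hΩ : i.Ω = cubeFam false L a Mc ρ i.k) (hΛs : i.Λs = cubeLamS L a Mc ρ i.k) (hρ : L ≤ ρ)
    {m : ℕ} (hm : m ≤ i.k) {δ : ℝ} (hδ0 : 0 < δ) (hδ : 4 * δ < alphaQ d L / (L : ℝ) ^ 2 * (((L : ℝ) ^ m)⁻¹) ^ 2)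
    {w : Site d → 𝔸ˣ} (hw : ∀ z, w z ∈ unitaryUnits 𝔸) {c : ℝ} (hc : 0 < c)
    (hcoer : ∀ U₀ ∈ (fun V => gaugeAct w V) ''
        {U : Site d → Fin d → 𝔸ˣ | (∀ x κ, U x κ ∈ unitaryUnits 𝔸) ∧ ∀ x κ, ‖((U x κ : 𝔸ˣ) : 𝔸) - 1‖ < δ},
      (∀ A ∈ domSubH (𝔸 := 𝔸) (i.Ω 0), A ≠ 0 → 0 < bondPair τ A (deltaAOf i.η (opsAllZd τ L (cubeLamBP L a Mc ρ i.k) ops₀ M i m) U₀ A)) →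
        ∀ A ∈ domSubH (𝔸 := 𝔸) (i.Ω 0), c * bondPair τ A A ≤ bondPair τ A (deltaAOf i.η (opsAllZd τ L (cubeLamBP L a Mc ρ i.k) ops₀ M i m) U₀ A)) :
    ∀ U₀ ∈ (fun V => gaugeAct w V) ''
        {U : Site d → Fin d → 𝔸ˣ | (∀ x κ, U x κ ∈ unitaryUnits 𝔸) ∧ ∀ x κ, ‖((U x κ : 𝔸ˣ) : 𝔸) - 1‖ < δ},
      ∀ A ∈ domSubH (𝔸 := 𝔸) (i.Ω 0), A ≠ 0 → 0 < bondPair τ A (deltaAOf i.η (opsAllZd τ L (cubeLamBP L a Mc ρ i.k) ops₀ M i m) U₀ A) := by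
  haveI : NeZero L := ⟨by omega⟩
  have hL1 : 1 ≤ L := le_trans (by norm_num) hL2
  have hfin := cubeMember_Ω0_finite i hΩ
  have hS𝒰 := image_ball_subset_reg17UnivP (𝔸 := 𝔸) hL1 m hδ hw
  have hstr := linear_herm_on_reg17UnivP τ hτt hτs hτp hL2 (cubeLamBP L a Mc ρ i.k) ops₀ M i m hfin
  -- positivity at the base point `1^w`: flat positivity transported along the orbit
  have h1reg := one_mem_reg17UnivP (d := d) (𝔸 := 𝔸) hL1 m
  have hcov := letterCovAt_deltaAOf_opsAllZd_of_reg17Univ τ L (cubeLamBP L a Mc ρ i.k) ops₀ M i m hL2 hτt hτs hτp h1reg.1 h1reg.2 hw hfin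
  have hpos1 : ∀ A ∈ domSubH (𝔸 := 𝔸) (i.Ω 0), A ≠ 0 →
      0 < bondPair τ A (deltaAOf i.η (opsAllZd τ L (cubeLamBP L a Mc ρ i.k) ops₀ M i m) 1 A) := fun A hA hA0 => by
    rw [mem_domSubH_iff] at hA
    exact flat_posDef_herm_cube τ hτt hτs hτp hd2 hL2 ops₀ M i hΩ hΛs hm hA.1 hA.2 hA0
  have hposw := posDefH_gaugeAct i.η _ (i.Ω 0) τ hτt hw hcov hpos1
  exact bondPair_pos_on_of_isPreconnected τ hτp hfin (isPreconnected_image_ball w hδ0 (delta_le_two_of_window hL1 hδ))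
    (fun U₀ hU => hstr.1 U₀ (hS𝒰 hU))
    (fun U₁ hU₁ => (lettersContinuousWithinAt_opsAllZd_cube_reg17UnivP τ hτp hτt hτs hd2 hL2 (cubeLamBP L a Mc ρ i.k) ops₀ M i hΩ hΛs hρ hm
      (hS𝒰 hU₁)).mono_set hS𝒰) hc hcoer (gaugeAct_one_mem_image_ball w hδ0) hposw

include hτp hτt hτs in
/-- ★★★ **… AND THEN `G_𝔤(U₀)` EXISTS ON THE WHOLE TRANSLATED BALL.** [cite: Balaban1985BackgroundPropagators, Thm 3.11 p.416, (3.27) p.395, (3.34) p.396, (3.115) p.418] -/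
theorem regularAtH_on_image_ball_of_coercive (hd2 : 2 ≤ d) (hL2 : 2 ≤ L) (ops₀ : ℝ → ZdIdx d L → ℕ → OpsZd d 𝔸) (M : ℝ)
    (i : ZdIdx d L) {a : Site d} {Mc ρ : ℕ} (hΩ : i.Ω = cubeFam false L a Mc ρ i.k) (hΛs : i.Λs = cubeLamS L a Mc ρ i.k) (hρ : L ≤ ρ)
    {m : ℕ} (hm : m ≤ i.k) {δ : ℝ} (hδ0 : 0 < δ) (hδ : 4 * δ < alphaQ d L / (L : ℝ) ^ 2 * (((L : ℝ) ^ m)⁻¹) ^ 2)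
    {w : Site d → 𝔸ˣ} (hw : ∀ z, w z ∈ unitaryUnits 𝔸) {c : ℝ} (hc : 0 < c)
    (hcoer : ∀ U₀ ∈ (fun V => gaugeAct w V) ''
        {U : Site d → Fin d → 𝔸ˣ | (∀ x κ, U x κ ∈ unitaryUnits 𝔸) ∧ ∀ x κ, ‖((U x κ : 𝔸ˣ) : 𝔸) - 1‖ < δ},
      (∀ A ∈ domSubH (𝔸 := 𝔸) (i.Ω 0), A ≠ 0 → 0 < bondPair τ A (deltaAOf i.η (opsAllZd τ L (cubeLamBP L a Mc ρ i.k) ops₀ M i m) U₀ A)) →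
        ∀ A ∈ domSubH (𝔸 := 𝔸) (i.Ω 0), c * bondPair τ A A ≤ bondPair τ A (deltaAOf i.η (opsAllZd τ L (cubeLamBP L a Mc ρ i.k) ops₀ M i m) U₀ A)) :
    ∀ U₀ ∈ (fun V => gaugeAct w V) ''
        {U : Site d → Fin d → 𝔸ˣ | (∀ x κ, U x κ ∈ unitaryUnits 𝔸) ∧ ∀ x κ, ‖((U x κ : 𝔸ˣ) : 𝔸) - 1‖ < δ},
      RegularAtH i.η (opsAllZd τ L (cubeLamBP L a Mc ρ i.k) ops₀ M i m) (i.Ω 0) U₀ := by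
  have hL1 : 1 ≤ L := le_trans (by norm_num) hL2
  have hfin := cubeMember_Ω0_finite i hΩ
  have hS𝒰 := image_ball_subset_reg17UnivP (𝔸 := 𝔸) hL1 m hδ hw
  have hstr := linear_herm_on_reg17UnivP τ hτt hτs hτp hL2 (cubeLamBP L a Mc ρ i.k) ops₀ M i m hfin
  intro U₀ hU₀
  exact regularAtH_of_bondPair_pos τ hfin (hstr.1 U₀ (hS𝒰 hU₀)) (hstr.2 U₀ (hS𝒰 hU₀))
    (bondPair_pos_on_image_ball_of_coercive τ hτp hτt hτs hd2 hL2 ops₀ M i hΩ hΛs hρ hm hδ0 hδ hw hc hcoer U₀ hU₀)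

end ContinuityMethod

end Literature.MathematicalPhysics.QuantumFieldTheory.Balaban1983to89.B9Thm311SmallFieldPathZdContinuity

end
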